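import Mathlib

/-!
# Solo (blind) rung s16b: the algebra behind LEMMA N — the Euler rate of the enstrophy production

Soloist report `sharpest.md` v16 §2.8, programme (S), LEMMA N and THEOREM S₃ (claims C48–C49).

Along a smooth solution of 3D Euler, with `A = ∇u`, `S = (A + Aᵀ)/2`, `ω = curl u` and `Π = ∇²p`,
the material derivatives are `Dω/Dt = A ω` and `DA/Dt = -A² - Π`, and `(A - Aᵀ) ω = ω × ω = 0`.
The pointwise identity proved here (`enstrophyProduction_material_rate`) is the algebraic core of

  `d/dt ∫ ωᵀ S ω = ∫ |S ω|² - ∫ ωᵀ Π ω`   (= ½ d²/dt² ∫ |ω|²),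

whose sign is shown INDEFINITE in the report by exact-arithmetic 2½-D witnesses. The remaining
lemmas are the exact structure facts of 2½-D fields `u = (U₁(x,y), U₂(x,y), f(x,y))` used there
(`A_f² = 0`, `tr(A_U A_f) = 0` so the pressure is that of `U` alone, `S_f ω_f = 0`,
`S_f (ω₃ e₃) = (ω₃/2) ∇f`), the trace identity `tr 𝕄_U = 2|S_U|²` of the reduced quadratic form,
and the indefiniteness of `𝕄_U` at an elliptic point with anisotropic pressure Hessian.
Everything is finite-dimensional real algebra; no analysis is formalised.
-/

set_option linter.dupNamespace false

namespace Summit.NavierStokesRegularity.NavierStokesRegularity.Theorems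

open Matrix

/-- Material-rate identity behind `d/dt ∫ωᵀSω = ∫|Sω|² − ∫ωᵀΠω`: if `(A − Aᵀ)ω = 0`
(ω is the axial vector of `A − Aᵀ`), `ω' = Aω` and `A' = −A² − Π`, then
`2 ω'·(Sω) + ωᵀ A' ω = |Sω|² − ωᵀΠω` with `S = (A + Aᵀ)/2` (the quadratic form of `A'` only sees
its symmetric part, so `S' = sym A'` may be replaced by `A'`). -/
theorem enstrophyProduction_material_rate (A P : Matrix (Fin 3) (Fin 3) ℝ) (ω : Fin 3 → ℝ)
    (h : (A - Aᵀ) *ᵥ ω = 0) :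
    2 * (A *ᵥ ω ⬝ᵥ (((1 / 2 : ℝ) • (A + Aᵀ)) *ᵥ ω)) + ω ⬝ᵥ ((-(A * A) - P) *ᵥ ω)
      = (((1 / 2 : ℝ) • (A + Aᵀ)) *ᵥ ω) ⬝ᵥ (((1 / 2 : ℝ) • (A + Aᵀ)) *ᵥ ω) - ω ⬝ᵥ (P *ᵥ ω) := by
  have h0 := congrFun h 0
  have h1 := congrFun h 1
  have h2 := congrFun h 2
  simp [Matrix.mulVec, dotProduct, Fin.sum_univ_three, Matrix.sub_apply,
    Matrix.transpose_apply] at h0 h1 h2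
  simp [Matrix.mulVec, dotProduct, Fin.sum_univ_three, Matrix.sub_apply, Matrix.add_apply,
    Matrix.transpose_apply, Matrix.mul_apply, Matrix.smul_apply, Matrix.neg_apply]
  linear_combination
    ((A 0 0 * ω 0 + A 0 1 * ω 1 + A 0 2 * ω 2)
        - (1 / 4 : ℝ) * ((A 0 0 - A 0 0) * ω 0 + (A 0 1 - A 1 0) * ω 1 + (A 0 2 - A 2 0) * ω 2)) * h0
    + ((A 1 0 * ω 0 + A 1 1 * ω 1 + A 1 2 * ω 2)
        - (1 / 4 : ℝ) * ((A 1 0 - A 0 1) * ω 0 + (A 1 1 - A 1 1) * ω 1 + (A 1 2 - A 2 1) * ω 2)) * h1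
    + ((A 2 0 * ω 0 + A 2 1 * ω 1 + A 2 2 * ω 2)
        - (1 / 4 : ℝ) * ((A 2 0 - A 0 2) * ω 0 + (A 2 1 - A 1 2) * ω 1 + (A 2 2 - A 2 2) * ω 2)) * h2

/-- The hypothesis `(A − Aᵀ)ω = 0` of `enstrophyProduction_material_rate` holds when `ω` is the
axial vector (vorticity) of `A`: `ωᵢ = εᵢⱼₖ A_kj`, i.e. `ω = (A₂₁ − A₁₂, A₀₂ − A₂₀, A₁₀ − A₀₁)`
in the report's convention `A i j = ∂ⱼ uᵢ` (so `ω = curl u`). -/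
theorem antisymm_mulVec_vorticity_eq_zero (A : Matrix (Fin 3) (Fin 3) ℝ) :
    (A - Aᵀ) *ᵥ ![A 2 1 - A 1 2, A 0 2 - A 2 0, A 1 0 - A 0 1] = 0 := by
  ext i
  fin_cases i <;>
    simp [Matrix.mulVec, dotProduct, Fin.sum_univ_three, Matrix.sub_apply,
      Matrix.transpose_apply] <;> ring

/-- 2½-D structure (i): the velocity gradient of the vertical component `(0,0,f(x,y))` is the
rank-one matrix `A_f = e₃ ⊗ g` with `g = (∂ₓf, ∂_y f, 0)`; it is nilpotent, `A_f² = 0`, so it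
contributes nothing to the pressure source `tr(A²)`. -/
theorem vertShear_sq_eq_zero (g0 g1 : ℝ) :
    let Af : Matrix (Fin 3) (Fin 3) ℝ := !![0, 0, 0; 0, 0, 0; g0, g1, 0]
    Af * Af = 0 := by
  intro Af
  ext i j
  fin_cases i <;> fin_cases j <;> simp [Af, Matrix.mul_apply, Fin.sum_univ_three]

/-- 2½-D structure (ii): for a planar base gradient `A_U` (zero third row and column) and the
vertical-shear gradient `A_f`, the cross pressure source vanishes: `tr(A_U A_f) = 0`. Together
with (i): `tr((A_U + A_f)²) = tr(A_U²)`, i.e. the pressure of a 2½-D field is that of its planar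
part. -/
theorem planar_vertShear_trace_zero (a00 a01 a10 a11 g0 g1 : ℝ) :
    let AU : Matrix (Fin 3) (Fin 3) ℝ := !![a00, a01, 0; a10, a11, 0; 0, 0, 0]
    let Af : Matrix (Fin 3) (Fin 3) ℝ := !![0, 0, 0; 0, 0, 0; g0, g1, 0]
    Matrix.trace (AU * Af) = 0 ∧
      Matrix.trace ((AU + Af) * (AU + Af)) = Matrix.trace (AU * AU) := by
  intro AU Af
  constructor <;>
    simp [AU, Af, Matrix.trace, Fin.sum_univ_three]

/-- 2½-D structure (iii): with `S_f = (A_f + A_fᵀ)/2` and the vertical-shear vorticity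
`ω_f = curl(0,0,f) = (∂_y f, −∂ₓ f, 0) = (g1, −g0, 0)`: `S_f ω_f = 0`; and on the planar vorticity
`ω₃ e₃`: `S_f (ω₃ e₃) = (ω₃/2) g`. Hence for a 2½-D field `Sω = S_U ω_f + (ω₃/2) ∇f` exactly. -/
theorem vertShear_strain_actions (g0 g1 w3 : ℝ) :
    let Sf : Matrix (Fin 3) (Fin 3) ℝ := !![0, 0, g0 / 2; 0, 0, g1 / 2; g0 / 2, g1 / 2, 0]
    Sf *ᵥ ![g1, -g0, 0] = 0 ∧ Sf *ᵥ ![0, 0, w3] = ![w3 / 2 * g0, w3 / 2 * g1, 0] := by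
  intro Sf
  constructor
  · ext i
    fin_cases i <;> simp [Sf, Matrix.mulVec, dotProduct, Fin.sum_univ_three]
    ring
  · ext i
    fin_cases i <;> simp [Sf, Matrix.mulVec, dotProduct, Fin.sum_univ_three] <;> ring

/-- The reduced 2½-D rate density is `∇fᵀ 𝕄_U ∇f` with
`𝕄_U = (S_U J + ½ω₃)ᵀ(S_U J + ½ω₃) − Jᵀ Π_U J`, `J` the rotation by −π/2, `S_U` the planar
traceless strain `[[s1, s2],[s2, −s1]]`, `Π_U` the planar pressure Hessian with
`tr Π_U = Δp_U = ½ω₃² − |S_U|²_F = ½ω₃² − 2(s1² + s2²)`. TRACE IDENTITY: `tr 𝕄_U = 2|S_U|²_F ≥ 0`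
— so negativity of the rate can only come from ANISOTROPY of `𝕄_U`. -/
theorem reducedRate_trace (s1 s2 w p11 p12 p22 : ℝ)
    (hp : p11 + p22 = w ^ 2 / 2 - 2 * (s1 ^ 2 + s2 ^ 2)) :
    let S : Matrix (Fin 2) (Fin 2) ℝ := !![s1, s2; s2, -s1]
    let J : Matrix (Fin 2) (Fin 2) ℝ := !![0, 1; -1, 0]
    let Pm : Matrix (Fin 2) (Fin 2) ℝ := !![p11, p12; p12, p22]
    let M : Matrix (Fin 2) (Fin 2) ℝ :=
      (S * J + (w / 2) • (1 : Matrix (Fin 2) (Fin 2) ℝ))ᵀ * (S * J + (w / 2) • 1) - Jᵀ * Pm * J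
    Matrix.trace M = 2 * (2 * (s1 ^ 2 + s2 ^ 2)) := by
  intro S J Pm M
  simp [M, S, J, Pm, Matrix.trace, Matrix.mul_apply, Matrix.add_apply, Matrix.sub_apply,
    Matrix.transpose_apply, Matrix.smul_apply, Fin.sum_univ_two, Matrix.one_apply]
  linear_combination (-1 : ℝ) * hp

/-- At an ELLIPTIC point of the planar base flow (`S_U = 0`, pure rotation with vorticity `w`)
the reduced matrix is `𝕄_U = (w²/4)·1 − Jᵀ Π_U J`; in the eigenframe of `Π_U = diag(h1, h2)`
(`h1 + h2 = w²/2`) its diagonal entries are `w²/4 − h2 = (h1 − h2)/2` and `w²/4 − h1 = (h2 − h1)/2`: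
opposite numbers. So `𝕄_U` is INDEFINITE as soon as the pressure Hessian is anisotropic
(`h1 ≠ h2`) — the mechanism of the negative witnesses of Lemma N (base flow
`U = (−½ sin 2y, sin x)`: `w = 2`, `Π_U(0) = diag(2/5, 8/5)`, entries `∓3/5`). -/
theorem ellipticPoint_indefinite (w h1 h2 : ℝ) (hsum : h1 + h2 = w ^ 2 / 2) (hne : h1 ≠ h2) :
    (w ^ 2 / 4 - h2) = (h1 - h2) / 2 ∧ (w ^ 2 / 4 - h1) = (h2 - h1) / 2 ∧
      (w ^ 2 / 4 - h2) * (w ^ 2 / 4 - h1) < 0 := by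
  refine ⟨by linarith, by linarith, ?_⟩
  have h' : (w ^ 2 / 4 - h2) * (w ^ 2 / 4 - h1) = -((h1 - h2) / 2) ^ 2 := by
    have e1 : w ^ 2 / 4 - h2 = (h1 - h2) / 2 := by linarith
    have e2 : w ^ 2 / 4 - h1 = -((h1 - h2) / 2) := by linarith
    rw [e1, e2]; ring
  rw [h']
  have : (0 : ℝ) < ((h1 - h2) / 2) ^ 2 := by
    have hne' : (h1 - h2) / 2 ≠ 0 := by
      intro h0; apply hne; linarith
    positivity
  linarith

/-- The concrete elliptic point of Lemma N's witness: base flow `U = (−½ sin 2y, sin x)` has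
`∇U(0) = [[0, −1],[1, 0]]` (pure rotation, `w = 2`), `p_U = −(2/5) cos x cos 2y`, hence
`Π_U(0) = diag(2/5, 8/5)`; the trace matches `w²/2 = 2` and the reduced matrix at 0 is
`diag(1 − 8/5, 1 − 2/5) = diag(−3/5, 3/5)`: vertical shear with `∇f ∥ e_x` near 0 has negative
rate density `−(3/5)|∂ₓ f|²`. -/
theorem witness_ellipticPoint_numbers :
    (2 : ℝ) / 5 + 8 / 5 = (2 : ℝ) ^ 2 / 2 ∧ (2 : ℝ) ^ 2 / 4 - 8 / 5 = -(3 / 5) ∧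
      (2 : ℝ) ^ 2 / 4 - 2 / 5 = 3 / 5 ∧
      (-(2 : ℝ) * (1 : ℝ) * (1 : ℝ)) / ((1 : ℝ) ^ 2 + (2 : ℝ) ^ 2) = -(2 / 5) := by
  norm_num

/-- Betchov-type bookkeeping used in Theorem S₃: for a traceless `3 × 3` matrix `A = S + Ω`
(`S` symmetric traceless, `Ω = ½[ω]_×` antisymmetric), `tr(A³) = tr(S³) − ¾ ωᵀ S ω`·(−1)… precisely
`tr(A³) = tr(S³) + 3 tr(S Ω²)` and `tr(S Ω²) = ¼(ωᵀ S ω − |ω|² tr S) = ¼ ωᵀ S ω`; since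
`∫ tr(A³) = 3∫ det A = 0` on divergence-free fields this gives Betchov's `∫tr S³ = −¾ ∫ωᵀSω`.
Here: the pointwise identity `tr(A³) = tr(S³) + ¾ ωᵀ S ω` for `A = S + ½[ω]_×`, `S` symmetric
with `tr S = 0`. -/
theorem trace_cube_strain_vorticity (s00 s01 s02 s11 s12 w0 w1 w2 : ℝ) :
    let S : Matrix (Fin 3) (Fin 3) ℝ :=
      !![s00, s01, s02; s01, s11, s12; s02, s12, -(s00 + s11)]
    let Ω : Matrix (Fin 3) (Fin 3) ℝ :=
      !![0, -w2 / 2, w1 / 2; w2 / 2, 0, -w0 / 2; -w1 / 2, w0 / 2, 0]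
    let ω : Fin 3 → ℝ := ![w0, w1, w2]
    Matrix.trace ((S + Ω) * (S + Ω) * (S + Ω))
      = Matrix.trace (S * S * S) + (3 / 4 : ℝ) * (ω ⬝ᵥ (S *ᵥ ω)) := by
  intro S Ω ω
  simp [S, Ω, ω, Matrix.trace, Fin.sum_univ_three, Matrix.mulVec, dotProduct]
  ring

end Summit.NavierStokesRegularity.NavierStokesRegularity.Theorems
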